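import Summits.AtomisticToContinuum.HydrodynamicLimit.Theses.EulerCharacteristics

/-!
# Record of the replaced route item `EulerCharacteristics.ExpTailBudget` (stmt-AtomisticToContinuum-14607)

Route `AtomisticToContinuum/EulerCharacteristics` replaced its item `ExpTailBudget`
(stmt-AtomisticToContinuum-14607) by a restated successor after it was closed `refuted`
(commit 31f5807f7540) by
`Summit.AtomisticToContinuum.HydrodynamicLimit.Theorems.EulerCharacteristicsExpTailBudget_refuted`
(`Theorems/EulerCharacteristicsExpTailBudgetRefutation.lean`). The gate-written route file
`Theses/EulerCharacteristics.lean` therefore no longer declares the constant, while the refutation —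
a Theorems file, append-only, whose statement text `¬ …Theses.EulerCharacteristics.ExpTailBudget` may
not change — still names it ("Unknown identifier", full builds of 2026-08-16). This module re-declares
the constant under its ORIGINAL fully-qualified name with its ORIGINAL definiens (the item's ledger
signature, verbatim, in the route file's namespace and `open` context), so that the refutation record
elaborates again; it is imported by that file only (which is at the 400-line cap of Theorems files,
hence the separate module). NOT a route item (no `route_item` attribute); FALSE (see the refutation).
-/

namespace Summit.AtomisticToContinuum.HydrodynamicLimit.Theses.EulerCharacteristics

open scoped BigOperators Topology Manifold Classical MeasureTheory ProbabilityTheory Matrix InnerProductSpace ComplexConjugate ContinuousMap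
open Filter Set Function TopologicalSpace MeasureTheory

/-- **Record of the replaced route item `ExpTailBudget`** = stmt-AtomisticToContinuum-14607 (ledger
signature verbatim; NOT a route item; FALSE — `Theorems.EulerCharacteristicsExpTailBudget_refuted`).
Re-declared only so that the refutation record keeps elaborating (see the module docstring). -/
def ExpTailBudget : Prop :=
  ∀ ηb : ℝ, 0 < ηb → ∀ (a₀ θ₀ : Literature.MathematicalPhysics.KineticTheory.T3 → ℝ) (u₀ : Literature.MathematicalPhysics.KineticTheory.T3 → Literature.MathematicalPhysics.KineticTheory.V3), Continuous a₀ → Continuous θ₀ → Continuous u₀ → (∀ x, 0 < a₀ x) → (∀ x, 0 < θ₀ x) → ∃ σ₀ : ℝ, 0 < σ₀ ∧ ∀ σ : ℝ, 0 < σ → σ < σ₀ → ∀ (T : ℝ) (ρ θ : ℝ → Literature.MathematicalPhysics.KineticTheory.T3 → ℝ) (u : ℝ → Literature.MathematicalPhysics.KineticTheory.T3 → Literature.MathematicalPhysics.KineticTheory.V3), Literature.MathematicalPhysics.KineticTheory.IsHardSphereEulerSolution σ T ρ u θ → (∀ t ∈ Set.Ico 0 T, ∀ x, ρ t x * σ ^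 3 < ηb) → ∀ Φ : (N : ℕ) → Literature.Analysis.FluidPDE.HardSphereFlow (Literature.Analysis.FluidPDE.Torus.geometry (Fin 3)) (Literature.MathematicalPhysics.KineticTheory.hsDiameter σ N) (N + 1), Literature.MathematicalPhysics.KineticTheory.TendstoHydroFieldsAt (fun N => Literature.MathematicalPhysics.KineticTheory.localGibbsLaw σ a₀ u₀ θ₀ N (Φ N)) Φ ρ u θ 0 → ∀ t ∈ Set.Ico 0 T, ∀ δ' : ℝ, 0 < δ' → ∃ A : ℝ, 0 < A ∧ ∃ c : ℝ, 0 < c ∧ ∀ᶠ N : ℕ in Filter.atTop, Literature.MathematicalPhysics.KineticTheory.localGibbsLaw σ a₀ u₀ θ₀ N (Φ N) {z | ∃ r ∈ Set.Icc 0 t, (let ℓ : ℝ := ((N + 1 : ℕ) : ℝ) ^ (-(1 / 4 : ℝ)); let χ : Literature.MathematicalPhysics.KineticTheory.T3 → Literature.MathematicalPhysics.KineticTheory.T3 → ℝ := fun x y => if Literature.Analysis.FluidPDE.Torus.euclidDist x y < ℓ then (4 / 3 * Real.pi * ℓ ^ 3)⁻¹ else 0; let ρℓ : Literature.MathematicalPhysics.KineticTheory.T3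 → ℝ := fun x => Literature.MathematicalPhysics.KineticTheory.empiricalDensityField ((Φ N).flow r z) (χ x); δ' < ∫ y, (1 + ‖y.2‖ ^ 3) * (if A < ‖y.2‖ then (1 : ℝ) else 0) ∂Literature.Analysis.FluidPDE.empiricalMeasure ((Φ N).flow r z) ∨ δ' < ∫ x, (if 2 * ηb < ρℓ x * σ ^ 3 then ρℓ x else 0))} ≤ ENNReal.ofReal (Real.exp (-(c * (N + 1))))

end Summit.AtomisticToContinuum.HydrodynamicLimit.Theses.EulerCharacteristics
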